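import Mathlib
import HarnessLib
import Literature.AlgebraicGeometry.Resolution.BlowupPrincipalCharts
import Literature.AlgebraicGeometry.Resolution.AlterationsProofs
import Summits.ResolutionOfSingularities.ResolutionOfSingularities.Theorems.WildQuotientsWildQuotientResolutionBlowupLocalExitAffine

/-!
# Regularity of the affine blow-up survives localisation of the base at one element
(crux stmt-ResolutionOfSingularities-15640 `WildQuotients.WildQuotientResolution`, line `Sketch`; chain w45c
post-V5 programme S2, scaffold F8 (`L/res-L1-w45c-lead-1/S2-DESIGN.md` §4/§5): the toric brick HT gives
`Bl_{J₀} Spec R₀` regular, the presentation brick HP presents the invariants as `R₀[1/ν]`; F8 needs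
`Bl_{J₀ R₀[1/ν]} Spec R₀[1/ν]` regular. [OURS · L1 W4.5c] — NOT a statement of the manuscript; folklore
(blowing up commutes with flat base change, Görtz–Wedhorn I Prop. 13.91, here for an open immersion via
`IsBlowup.restrict_isoSpec` + uniqueness). Lead prover res-L1-w45c-lead-1.)

* `BlowupExit.isRegular_affineBlowup_ideal_basicOpen` — `Bl_{J(D(ν))} Spec Γ(D(ν))` is regular;
* **`BlowupExit.isRegular_affineBlowup_map_away`** — `Bl_{J·R[1/ν]} Spec R[1/ν]` is regular.
-/

-- single-problem summit: the doubled namespace component `ResolutionOfSingularities` is forced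
set_option linter.dupNamespace false

noncomputable section

open CategoryTheory AlgebraicGeometry TopologicalSpace
open Literature.AlgebraicGeometry.Resolution

universe u

namespace Summit.ResolutionOfSingularities.ResolutionOfSingularities.Theorems.WildQuotientResolution.BlowupExit

/-- The principal open `D(ν) ⊆ Spec R` as an affine open. [folklore] -/
theorem isAffineOpen_primeSpectrum_basicOpen {R : Type u} [CommRing R] (ν : R) :
    IsAffineOpen (X := Spec (CommRingCat.of R)) (PrimeSpectrum.basicOpen ν) := by
  have h : (Spec (CommRingCat.of R)).basicOpen ((Scheme.ΓSpecIso (CommRingCat.of R)).inv ν) =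
      PrimeSpectrum.basicOpen ν := AlgebraicGeometry.basicOpen_eq_of_affine (R := CommRingCat.of R) ν
  rw [← h]
  exact (isAffineOpen_top (Spec (CommRingCat.of R))).basicOpen _

/-- **The blow-up of the restricted ideal over `D(ν)` is regular** when `Bl_J Spec R` is.
[cite: GortzWedhorn2020, Prop. 13.91] -/
theorem isRegular_affineBlowup_ideal_basicOpen {R : Type u} [CommRing R] (J : Ideal R) (ν : R)
    (hreg : Scheme.IsRegular (affineBlowup J)) :
    Scheme.IsRegular (affineBlowup ((affineBlowup.idealSheaf J).ideal
      ⟨PrimeSpectrum.basicOpen ν, isAffineOpen_primeSpectrum_basicOpen ν⟩)) := by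
  set U : (Spec (CommRingCat.of R)).affineOpens :=
    ⟨PrimeSpectrum.basicOpen ν, isAffineOpen_primeSpectrum_basicOpen ν⟩
  have h1 := (affineBlowup.isBlowup J).restrict_isoSpec U
  have h2 := affineBlowup.isBlowup ((affineBlowup.idealSheaf J).ideal U)
  obtain ⟨e, -, -⟩ := h1.unique h2
  have hreg' : Scheme.IsRegular ((affineBlowup.π J ⁻¹ᵁ (U : (Spec (CommRingCat.of R)).Opens) :
      (affineBlowup J).Opens) : Scheme.{u}) :=
    Scheme.IsRegular.of_isOpenImmersion (Scheme.Opens.ι _) hreg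
  exact Scheme.IsRegular.of_isOpenImmersion e.inv hreg'

/-- **Regularity of `Bl_{J R[1/ν]} Spec R[1/ν]`** from regularity of `Bl_J Spec R`.
[cite: GortzWedhorn2020, Prop. 13.91] -/
theorem isRegular_affineBlowup_map_away {R : Type u} [CommRing R] (J : Ideal R) (ν : R)
    (hreg : Scheme.IsRegular (affineBlowup J)) :
    Scheme.IsRegular (affineBlowup (J.map (algebraMap R (Localization.Away ν)))) := by
  set X : Scheme.{u} := Spec (CommRingCat.of R)
  set r : Γ(X, ⊤) := (Scheme.ΓSpecIso (CommRingCat.of R)).inv ν with hr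
  have hUeq : X.basicOpen r = PrimeSpectrum.basicOpen ν :=
    AlgebraicGeometry.basicOpen_eq_of_affine (R := CommRingCat.of R) ν
  set U : X.affineOpens := ⟨X.basicOpen r, (isAffineOpen_top X).basicOpen r⟩
  -- `Γ(X, D(r))` is the localisation of `Γ(X, ⊤)` away from `r`
  haveI hloc : IsLocalization.Away r Γ(X, X.basicOpen r) := (isAffineOpen_top X).isLocalization_basicOpen r
  let h : Γ(X, ⊤) ≃+* R := (Scheme.ΓSpecIso (CommRingCat.of R)).commRingCatIsoToRingEquiv
  have hh : ∀ y, h y = (Scheme.ΓSpecIso (CommRingCat.of R)).hom y := fun _ => rfl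
  have hmap : (Submonoid.powers r).map h.toMonoidHom = Submonoid.powers ν := by
    rw [Submonoid.map_powers]
    congr 1
    change ((Scheme.ΓSpecIso (CommRingCat.of R)).inv ≫ (Scheme.ΓSpecIso (CommRingCat.of R)).hom).hom ν = ν
    rw [Iso.inv_hom_id]; rfl
  let φ : Γ(X, X.basicOpen r) ≃+* Localization.Away ν :=
    IsLocalization.ringEquivOfRingEquiv Γ(X, X.basicOpen r) (Localization.Away ν) h hmap
  -- the restricted ideal is `J · Γ(X, D(r))`
  have hJ : (affineBlowup.idealSheaf J).ideal U =
      J.map ((algebraMap Γ(X, ⊤) Γ(X, X.basicOpen r)).comp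
        (Scheme.ΓSpecIso (CommRingCat.of R)).inv.hom) := by
    rw [affineBlowup.idealSheaf, Scheme.IdealSheafData.ofIdealTop_ideal, Ideal.map_map]
    rfl
  have hreg₁ : Scheme.IsRegular (affineBlowup ((affineBlowup.idealSheaf J).ideal U)) := by
    have h1 := (affineBlowup.isBlowup J).restrict_isoSpec U
    have h2 := affineBlowup.isBlowup ((affineBlowup.idealSheaf J).ideal U)
    obtain ⟨e, -, -⟩ := h1.unique h2
    have hreg' : Scheme.IsRegular ((affineBlowup.π J ⁻¹ᵁ (U : X.Opens) : (affineBlowup J).Opens) :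
        Scheme.{u}) :=
      Scheme.IsRegular.of_isOpenImmersion (Scheme.Opens.ι _) hreg
    exact Scheme.IsRegular.of_isOpenImmersion e.inv hreg'
  have h3 := isRegular_affineBlowup_map_ringEquiv φ _ hreg₁
  rw [hJ, Ideal.map_map] at h3
  have hcomp : (φ : Γ(X, X.basicOpen r) →+* Localization.Away ν).comp
      ((algebraMap Γ(X, ⊤) Γ(X, X.basicOpen r)).comp (Scheme.ΓSpecIso (CommRingCat.of R)).inv.hom) =
      algebraMap R (Localization.Away ν) := by
    ext x
    change φ (algebraMap Γ(X, ⊤) Γ(X, X.basicOpen r) ((Scheme.ΓSpecIso (CommRingCat.of R)).inv x)) = _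
    rw [IsLocalization.ringEquivOfRingEquiv_eq, hh]
    congr 1
    change ((Scheme.ΓSpecIso (CommRingCat.of R)).inv ≫ (Scheme.ΓSpecIso (CommRingCat.of R)).hom).hom x = x
    rw [Iso.inv_hom_id]; rfl
  rwa [hcomp] at h3

end Summit.ResolutionOfSingularities.ResolutionOfSingularities.Theorems.WildQuotientResolution.BlowupExit

end
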